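import Literature.MathematicalPhysics.KineticTheory.FouriersLaw

/-!
# Site-inhomogeneous oscillator chains between Langevin heat baths; dilute cell chains

Topic `Literature/MathematicalPhysics/KineticTheory`, grouping namespace `…KineticTheory.HeatConduction`
of `FouriersLaw.lean`, whose `OscillatorChain` this file generalises one-for-one. Definition request
`defn-CellChain` (route `AtomisticToContinuum/FouriersLaw/Theses/DilutePhononLorentzGas`: items
CellMonotonicity stmt-3679, DiluteCellsBoundedResponse stmt-3680, CellMixing stmt-3669, glue
DiluteToDense; card matthiessen-increments-over-anharmonic-sites). `SiteChain` is also the object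
route `MatthiessenIncrements` inlines as `let`-bindings (items 3610–3613) and requests as
`SiteDependentChain` — same data, same formulas; only its real-profile instance is not defined here.

## The model

Bonetto–Lebowitz–Rey-Bellet 2000, §3 eq. (8): the crystal Hamiltonian
`H = ∑_i p_i²/2m + ∑_{|i-j|=1} V(q_i - q_j) + ∑_i U_i(q_i)` already has a SITE-DEPENDENT pinning `U_i`
("for many purpose it is enough to put the potential `U_i` on only some of the atoms"); §4.1
eq. (10) Langevin reservoirs, §5.2 eq. (23) bond current. Cuneo–Eckmann–Hairer–Rey-Bellet 2018, §2
eq. (2.1)–(2.2): oscillator NETWORKS `H = ∑_v (p_v²/2 + U_v(q_v)) + ∑_e V_e(δq_e)` with vertex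
potentials `U_v`, EDGE potentials `V_e` and Langevin baths `-γ_b p_b dt + √(2T_bγ_b) dW_b` on a vertex
subset `B`. Dhar 2008, §3.1 (harmonic hosts with arbitrary masses / force matrix) and §5 (first
display: disordered chain `∑_l [p_l²/2m_l + k_o x_l²/2 + λ x_l⁴/4] + ∑_l [k r_l²/2 + ν r_l⁴/4]`).
Here: the CEHRB network on the PATH GRAPH `{0, …, N-1}` — vertex `i` carries `U i`, edge `(i, i+1)`
carries `V i` — with baths of equal coupling `γ` at sites `0` (temperature `T_L`) and `N - 1`
(`T_R`), i.e. `OscillatorChain` with `U ↦ U i`, `V ↦ V i`; data indexed by `ℕ` so that ONE object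
serves every length `N`.

## Contents and design choices

* `SiteChain` (`U V : ℕ → ℝ → ℝ`, `γ : ℝ`) with, copied VERBATIM from `OscillatorChain` under
  `P.U ↦ P.U i.val`, `P.V ↦ P.V i.val`: `hamiltonian`, `generator`, `bondCurrent`, `totalCurrent`,
  `IsSteadyState` (`noncomputable`/`deriv`-based exactly as there: baths at `i.val = 0` and
  `i.val = N - 1`, bond sums over `j = i + 1`, junk `deriv 0` for non-differentiable `V i`); the
  linear-response vocabulary of the requesting items: `IsResponseCoeff N T D` (a finite-`N` response
  coefficient along SOME steady-state family at size `N` — the `let Resp` of MatthiessenIncrements,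
  the "`D_N(c,T)`" of CellMonotonicity), `HasBoundedResponseAt T` (DiluteCellsBoundedResponse: "the
  analogue of `HasBoundedResponse` at temperature `T`") and `HasBoundedResponse` (verbatim the body
  of the catalogued `Literature.Barriers.AtomisticToContinuum.HasBoundedResponse`, same quantifier
  order; the family forms quantify over steady-state families at ALL sizes and are vacuous for a
  chain lacking a steady state at some size, `hasBoundedResponseAt_of_forall_isResponseCoeff` links
  the two); locality lemmas `*_congr` (size-`N` objects depend on `γ` and `U i, V i`, `i < N` only).
* `OscillatorChain.toSiteChain P = ⟨fun _ => P.U, fun _ => P.V, P.γ⟩`; the agreement lemmas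
  `toSiteChain_hamiltonian/generator/bondCurrent/totalCurrent/isSteadyState` are all `rfl`, and
  `toSiteChain_hasBoundedResponse_iff` unfolds by `Iff.rfl` to the barrier's body (so the link with
  the catalogue is `Iff.rfl` for a joint importer; the barrier module is deliberately NOT imported
  into this definitional file).
* `cellChain ω₂ lam β γ (c : ℕ → Bool)`: the `ω₂`-pinned unit-coupling harmonic host with the quartic
  terms of `pinnedChain ω₂ lam β γ` (pinning `lam q⁴/4` at site `i` AND coupling `β r⁴/4` on the bond
  `(i, i+1)`) switched on exactly at the cells `c i = true` (`ℕ → Bool` is ordered pointwise with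
  `false < true`: the "`c ≤ c'`" of CellMonotonicity). The amplitude `(if c i then lam else 0)` makes
  `cellChain ω₂ lam β γ (fun _ => true) = (pinnedChain ω₂ lam β γ).toSiteChain` and
  `… (fun _ => false) = (pinnedChain ω₂ 0 0 γ).toSiteChain` hold by `rfl` (equality of chains, not
  only of potentials), so statements about the dense cell chain REWRITE to the conjunct's chain. A
  real profile (`c i * lam * q ^ 4 / 4`) is another `SiteChain`-valued family (request
  `defn-SiteDependentChain`).
* `cellPeriodic ℓ i = decide (ℓ ∣ i + 1)` (cells at `i ≡ ℓ - 1 (mod ℓ)`; `ℓ = 1` all cells, `ℓ = 0`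
  none), `cellPeriodic_one/zero`, periodicity, `cellChain_cellPeriodic_one/zero`.
* No dynamics / semigroup / infinite-volume object, no named fact: definitions and `rfl`/`simp` API
  only. Searched (`lean search`): `SiteChain`, `SiteDependentChain`, `cellChain`,
  `mixedPinnedChain`, `inhomogeneous` — nothing in Mathlib or Literature.
-/

noncomputable section

open MeasureTheory Filter Topology
open scoped ContDiff

namespace Literature.MathematicalPhysics.KineticTheory.HeatConduction

/-- A chain of unit-mass oscillators between Langevin heat baths with SITE-DEPENDENT data: `U i` is
the pinning (on-site) potential at site `i`, `V i` the interaction potential of the bond `(i, i+1)`,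
`γ` the coupling constant of the two baths (acting at sites `0` and `N - 1`); indexed by `ℕ` so that
one object describes the chain at every length `N`: the oscillator network of Cuneo–Eckmann–Hairer–
Rey-Bellet (vertex potentials `U_v`, edge potentials `V_e`, baths on a vertex subset) on the path
graph `{0, …, N-1}` with baths at both ends; for constant `V`, Bonetto–Lebowitz–Rey-Bellet's crystal
Hamiltonian (8) (`d = 1`), whose pinning `U_i` is already site-dependent. [Bonetto–Lebowitz–Rey-Bellet
2000, §3 eq. (8)] [cite: CuneoEckmannHairerReyBellet2018, §2 eq. (2.1)-(2.2)] -/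
@[ext]
structure SiteChain where
  /-- the pinning (on-site) potential `U i` at site `i` -/
  U : ℕ → ℝ → ℝ
  /-- the interaction potential `V i` of the bond `(i, i+1)` -/
  V : ℕ → ℝ → ℝ
  /-- the coupling constant `γ` of the Langevin baths at the two ends (friction `γ`, noise
  `√(2γT)`) -/
  γ : ℝ

namespace SiteChain

variable (P : SiteChain)

/-- The Hamiltonian `H(q, p) = ∑_i (p_i²/2 + U_i(q_i)) + ∑_{bonds (i, i+1)} V_i(q_{i+1} - q_i)` of the
`N`-site chain (free ends, unit masses; bond sum as a double sum over `j = i + 1`) —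
`OscillatorChain.hamiltonian` with `U ↦ U i`, `V ↦ V i`. [Bonetto–Lebowitz–Rey-Bellet 2000, §3
eq. (8) (`d = 1`, `m = 1`, site-dependent `U_i` as printed); Cuneo–Eckmann–Hairer–Rey-Bellet 2018,
§2 eq. (2.1) (edge potentials) on the path graph] [cite: BonettoLebowitzReyBellet2000, §3 eq. (8)] -/
def hamiltonian (N : ℕ) (x : PhaseSpace N) : ℝ :=
  (∑ i, (x.2 i ^ 2 / 2 + P.U i.val (x.1 i))) +
    ∑ i : Fin N, ∑ j : Fin N, if j.val = i.val + 1 then P.V i.val (x.1 j - x.1 i) else 0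

/-- The generator of the chain coupled to Langevin baths at temperature `T_L` on site `0` and `T_R`
on site `N - 1`:
`L f = ∑_i (p_i ∂_{q_i} f - ∂_{q_i}H ∂_{p_i} f) + γ ∑_{i = 0} (T_L ∂²_{p_i} f - p_i ∂_{p_i} f) + γ ∑_{i = N-1} (T_R ∂²_{p_i} f - p_i ∂_{p_i} f)`
— the SAME formula as `OscillatorChain.generator`, with the site-dependent Hamiltonian.
[Bonetto–Lebowitz–Rey-Bellet 2000, §4.1 eq. (10) (`λ_α = γ`, `m_i = 1`); Cuneo–Eckmann–Hairer–Rey-Bellet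
2018, §2 eq. (2.2) with `B = {0, N-1}`, `γ_b = γ`] [cite: BonettoLebowitzReyBellet2000, §4.1 eq. (10)] -/
def generator (N : ℕ) (T_L T_R : ℝ) (f : PhaseSpace N → ℝ) (x : PhaseSpace N) : ℝ :=
  (∑ i, (x.2 i * partialQ i f x - partialQ i (P.hamiltonian N) x * partialP i f x)) +
    P.γ * ∑ i : Fin N,
      ((if i.val = 0 then T_L * partialP i (partialP i f) x - x.2 i * partialP i f x else 0) +
        (if i.val = N - 1 then T_R * partialP i (partialP i f) x - x.2 i * partialP i f x else 0))

/-- The energy current through the bond `(i, i+1)`: `j_i = -½ (p_i + p_{i+1}) V_i'(q_{i+1} - q_i)`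
(`0` if `i` is the last site) — `OscillatorChain.bondCurrent` with the bond's own potential `V i`.
[Bonetto–Lebowitz–Rey-Bellet 2000, §5.2 eq. (23); Dhar 2008, §3.1 (`J_{n→l} = -(Φ_{ln} x_n) p_l/m_l`)]
[cite: BonettoLebowitzReyBellet2000, §5.2 eq. (23)] -/
def bondCurrent (N : ℕ) (i : Fin N) (x : PhaseSpace N) : ℝ :=
  ∑ j : Fin N, if j.val = i.val + 1 then
    -((x.2 i + x.2 j) / 2 * deriv (P.V i.val) (x.1 j - x.1 i)) else 0

/-- The space-summed steady energy current `∑_{bonds} ∫ j_i dμ` (`= (N-1) J̃` in a steady state) —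
`OscillatorChain.totalCurrent` verbatim. [Bonetto–Lebowitz–Rey-Bellet 2000, §1, §5.2 eq. (24)–(27)]
[cite: BonettoLebowitzReyBellet2000, §1] -/
def totalCurrent {N : ℕ} (μ : Measure (PhaseSpace N)) : ℝ :=
  ∑ i : Fin N, ∫ x, P.bondCurrent N i x ∂μ

/-- `P.IsSteadyState N T_L T_R μ`: `μ` is a probability measure solving the stationary
Fokker–Planck equation weakly (`∫ L f dμ = 0` for smooth compactly supported `f`) with integrable bond
currents — `OscillatorChain.IsSteadyState` verbatim. [Bonetto–Lebowitz–Rey-Bellet 2000, §1, §5.1;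
Cuneo–Eckmann–Hairer–Rey-Bellet 2018, Thm 2.13 (invariant measure of networks under C1–C5)]
[cite: BonettoLebowitzReyBellet2000, §5.1] -/
def IsSteadyState (N : ℕ) (T_L T_R : ℝ) (μ : Measure (PhaseSpace N)) : Prop :=
  IsProbabilityMeasure μ ∧
    (∀ f : PhaseSpace N → ℝ, ContDiff ℝ ∞ f → HasCompactSupport f →
      ∫ x, P.generator N T_L T_R f x ∂μ = 0) ∧
    ∀ i : Fin N, Integrable (P.bondCurrent N i) μ

/-- `P.IsResponseCoeff N T D`: `D` is a finite-size linear-response coefficient (finite-size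
conductivity `κ_N` up to `(N-1)/N`) of the `N`-site chain at temperature `T` — along SOME family
`μ T_L T_R` of steady states over the bath temperatures `T_L, T_R > 0`,
`D = lim_{δ→0, δ≠0} totalCurrent (μ (T+δ/2) (T-δ/2)) / δ` (the `let Resp` of MatthiessenIncrements).
[Bonetto–Lebowitz–Rey-Bellet 2000, §5.3 eq. (31)–(33)] [cite: BonettoLebowitzReyBellet2000, §5.3 eq. (33)] -/
def IsResponseCoeff (N : ℕ) (T D : ℝ) : Prop :=
  ∃ μ : ℝ → ℝ → Measure (PhaseSpace N),
    (∀ T_L T_R : ℝ, 0 < T_L → 0 < T_R → P.IsSteadyState N T_L T_R (μ T_L T_R)) ∧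
      Tendsto (fun δ : ℝ => P.totalCurrent (μ (T + δ / 2) (T - δ / 2)) / δ) (𝓝[≠] 0) (𝓝 D)

/-- `P.HasBoundedResponseAt T`: for every family `μ N T_L T_R` of steady states and every sequence
`D` of response limits at temperature `T` (`D N = lim_{δ→0, δ≠0} totalCurrent (μ N (T+δ/2) (T-δ/2))/δ`
for all `N`), `(|D N|)_N` is bounded — the fixed-`T` slice of `HasBoundedResponse`.
[Bonetto–Lebowitz–Rey-Bellet 2000, §6.3 ("nothing is known about the dependence of `D` on `L`")]
[cite: BonettoLebowitzReyBellet2000, §6.3] -/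
def HasBoundedResponseAt (T : ℝ) : Prop :=
  ∀ μ : (N : ℕ) → ℝ → ℝ → Measure (PhaseSpace N),
    (∀ (N : ℕ) (T_L T_R : ℝ), 0 < T_L → 0 < T_R → P.IsSteadyState N T_L T_R (μ N T_L T_R)) →
    ∀ D : ℕ → ℝ,
      (∀ N : ℕ, Tendsto (fun δ : ℝ => P.totalCurrent (μ N (T + δ / 2) (T - δ / 2)) / δ)
        (𝓝[≠] 0) (𝓝 (D N))) →
      BddAbove (Set.range fun N => |D N|)

/-- `P.HasBoundedResponse`: bounded response at every `T > 0` — VERBATIM the body of the catalogued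
`Literature.Barriers.AtomisticToContinuum.HasBoundedResponse` (same quantifier order), for
site-inhomogeneous chains. [Bonetto–Lebowitz–Rey-Bellet 2000, §6.3] [cite: BonettoLebowitzReyBellet2000, §6.3] -/
def HasBoundedResponse (P : SiteChain) : Prop :=
  ∀ μ : (N : ℕ) → ℝ → ℝ → Measure (PhaseSpace N),
    (∀ (N : ℕ) (T_L T_R : ℝ), 0 < T_L → 0 < T_R → P.IsSteadyState N T_L T_R (μ N T_L T_R)) →
    ∀ T : ℝ, 0 < T → ∀ D : ℕ → ℝ,
      (∀ N : ℕ, Tendsto (fun δ : ℝ => P.totalCurrent (μ N (T + δ / 2) (T - δ / 2)) / δ)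
        (𝓝[≠] 0) (𝓝 (D N))) →
      BddAbove (Set.range fun N => |D N|)

/-! ### API: unfolding, degenerate cases, locality -/

/-- `HasBoundedResponse` is `HasBoundedResponseAt T` for all `T > 0` (quantifier swap). [folklore] -/
theorem hasBoundedResponse_iff_forall_hasBoundedResponseAt :
    P.HasBoundedResponse ↔ ∀ T : ℝ, 0 < T → P.HasBoundedResponseAt T :=
  ⟨fun h T hT μ hμ D hD => h μ hμ T hT D hD, fun h μ hμ T hT D hD => h T hT μ hμ D hD⟩

/-- A uniform bound on all response coefficients at `T` gives bounded response at `T` (the converse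
needs uniqueness of steady states). [folklore] -/
theorem hasBoundedResponseAt_of_forall_isResponseCoeff {P : SiteChain} {T C : ℝ}
    (h : ∀ (N : ℕ) (D : ℝ), P.IsResponseCoeff N T D → |D| ≤ C) : P.HasBoundedResponseAt T :=
  fun μ hμ D hD => ⟨C, by
    rintro _ ⟨N, rfl⟩
    exact h N (D N) ⟨μ N, fun T_L T_R hL hR => hμ N T_L T_R hL hR, hD N⟩⟩

/-- The empty chain (`N = 0`): every probability measure on the one-point phase space is a steady
state (the generator vanishes, there are no bonds). [folklore] -/
theorem isSteadyState_zero (T_L T_R : ℝ) (μ : Measure (PhaseSpace 0)) [IsProbabilityMeasure μ] :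
    P.IsSteadyState 0 T_L T_R μ := by
  refine ⟨inferInstance, fun f _ _ => ?_, fun i => i.elim0⟩
  simp [generator]

/-- Locality of the Hamiltonian: at length `N` it only involves `U i, V i` for `i < N`. [folklore] -/
theorem hamiltonian_congr {P P' : SiteChain} {N : ℕ} (hU : ∀ i, i < N → P.U i = P'.U i)
    (hV : ∀ i, i < N → P.V i = P'.V i) : P.hamiltonian N = P'.hamiltonian N := by
  funext x
  simp only [hamiltonian]
  congr 1
  · exact Finset.sum_congr rfl fun i _ => by rw [hU i i.isLt]
  · exact Finset.sum_congr rfl fun i _ => Finset.sum_congr rfl fun j _ => by rw [hV i i.isLt]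

/-- Locality of the generator. [folklore] -/
theorem generator_congr {P P' : SiteChain} {N : ℕ} (hU : ∀ i, i < N → P.U i = P'.U i)
    (hV : ∀ i, i < N → P.V i = P'.V i) (hγ : P.γ = P'.γ) : P.generator N = P'.generator N := by
  funext T_L T_R f x
  simp only [generator, hamiltonian_congr hU hV, hγ]

/-- Locality of the bond currents. [folklore] -/
theorem bondCurrent_congr {P P' : SiteChain} {N : ℕ} (hV : ∀ i, i < N → P.V i = P'.V i) :
    P.bondCurrent N = P'.bondCurrent N := by
  funext i x
  simp only [bondCurrent]
  exact Finset.sum_congr rfl fun j _ => by rw [hV i i.isLt]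

/-- Locality of the total current. [folklore] -/
theorem totalCurrent_congr {P P' : SiteChain} {N : ℕ} (hV : ∀ i, i < N → P.V i = P'.V i)
    (μ : Measure (PhaseSpace N)) : P.totalCurrent μ = P'.totalCurrent μ := by
  simp only [totalCurrent, bondCurrent_congr hV]

/-- Locality of the steady-state predicate. [folklore] -/
theorem isSteadyState_congr {P P' : SiteChain} {N : ℕ} (hU : ∀ i, i < N → P.U i = P'.U i)
    (hV : ∀ i, i < N → P.V i = P'.V i) (hγ : P.γ = P'.γ) :
    P.IsSteadyState N = P'.IsSteadyState N := by
  funext T_L T_R μ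
  simp only [IsSteadyState, generator_congr hU hV hγ, bondCurrent_congr hV]

/-- Locality of the response coefficients. [folklore] -/
theorem isResponseCoeff_congr {P P' : SiteChain} {N : ℕ} (hU : ∀ i, i < N → P.U i = P'.U i)
    (hV : ∀ i, i < N → P.V i = P'.V i) (hγ : P.γ = P'.γ) :
    P.IsResponseCoeff N = P'.IsResponseCoeff N := by
  funext T D
  simp only [IsResponseCoeff, isSteadyState_congr hU hV hγ, totalCurrent_congr hV]

end SiteChain

/-! ### Constant chains: the embedding of `OscillatorChain` -/

namespace OscillatorChain

/-- A homogeneous chain as a site chain with constant data `U_i = U`, `V_i = V`. [folklore] -/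
def toSiteChain (P : OscillatorChain) : SiteChain := ⟨fun _ => P.U, fun _ => P.V, P.γ⟩

variable (P : OscillatorChain)

/-- Constant pinning. [folklore] -/
@[simp] theorem toSiteChain_U (i : ℕ) : P.toSiteChain.U i = P.U := rfl
/-- Constant coupling. [folklore] -/
@[simp] theorem toSiteChain_V (i : ℕ) : P.toSiteChain.V i = P.V := rfl
/-- Same bath coupling. [folklore] -/
@[simp] theorem toSiteChain_γ : P.toSiteChain.γ = P.γ := rfl

/-- The embedding preserves the Hamiltonian, definitionally. [folklore] -/
@[simp] theorem toSiteChain_hamiltonian (N : ℕ) : P.toSiteChain.hamiltonian N = P.hamiltonian N :=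
  rfl

/-- The embedding preserves the generator, definitionally. [folklore] -/
@[simp] theorem toSiteChain_generator (N : ℕ) : P.toSiteChain.generator N = P.generator N := rfl

/-- The embedding preserves the bond currents, definitionally. [folklore] -/
@[simp] theorem toSiteChain_bondCurrent (N : ℕ) : P.toSiteChain.bondCurrent N = P.bondCurrent N :=
  rfl

/-- The embedding preserves the total current, definitionally. [folklore] -/
@[simp] theorem toSiteChain_totalCurrent {N : ℕ} (μ : Measure (PhaseSpace N)) :
    P.toSiteChain.totalCurrent μ = P.totalCurrent μ := rfl

/-- The embedding preserves steady states, definitionally. [folklore] -/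
@[simp] theorem toSiteChain_isSteadyState (N : ℕ) :
    P.toSiteChain.IsSteadyState N = P.IsSteadyState N := rfl

/-- Bounded response of a constant site chain, unfolded: the right-hand side is verbatim the body of
`Literature.Barriers.AtomisticToContinuum.HasBoundedResponse P`, so in a file importing both the
equivalence with the catalogued barrier predicate is `Iff.rfl`. [folklore] -/
theorem toSiteChain_hasBoundedResponse_iff :
    P.toSiteChain.HasBoundedResponse ↔
      ∀ μ : (N : ℕ) → ℝ → ℝ → Measure (PhaseSpace N),
        (∀ (N : ℕ) (T_L T_R : ℝ), 0 < T_L → 0 < T_R → P.IsSteadyState N T_L T_R (μ N T_L T_R)) →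
        ∀ T : ℝ, 0 < T → ∀ D : ℕ → ℝ,
          (∀ N : ℕ, Tendsto (fun δ : ℝ => P.totalCurrent (μ N (T + δ / 2) (T - δ / 2)) / δ)
            (𝓝[≠] 0) (𝓝 (D N))) →
          BddAbove (Set.range fun N => |D N|) :=
  Iff.rfl

end OscillatorChain

/-! ### Cell chains: dilute quartic cells in the pinned harmonic host -/

/-- The CELL CHAIN with cell indicator `c : ℕ → Bool`: the `ω₂`-pinned, unit-coupling harmonic chain
between Langevin baths `γ` in which the quartic terms of the conjunct's `pinnedChain ω₂ lam β γ` —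
the pinning `lam q_i⁴/4` at site `i` and the FPU-β coupling `β (q_{i+1} - q_i)⁴/4` on the bond
`(i, i+1)` — are switched on exactly at the cells, the sites `i` with `c i = true`:
`U_i(q) = ω₂ q²/2 + [c i] lam q⁴/4`, `V_i(r) = r²/2 + [c i] β r⁴/4`. The constant profiles are
DEFINITIONALLY `pinnedChain ω₂ lam β γ` (`c ≡ true`) and the pinned harmonic chain
`pinnedChain ω₂ 0 0 γ` (`c ≡ false`), see `cellChain_const_true/false`. An instance of BLR's class
(8) ("the potential `U_i` on only some of the atoms") within the pinned quartic family of their §10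
item 1; Dhar 2008 §5 (first display) with unit masses and `λ_l ∈ {0, lam}`, `ν_l ∈ {0, β}`.
[Bonetto–Lebowitz–Rey-Bellet 2000, §3 eq. (8), §10 item 1] [cite: BonettoLebowitzReyBellet2000, §3 eq. (8) and §10 item 1] -/
def cellChain (ω₂ lam β γ : ℝ) (c : ℕ → Bool) : SiteChain where
  U i q := ω₂ * q ^ 2 / 2 + (if c i then lam else 0) * q ^ 4 / 4
  V i r := r ^ 2 / 2 + (if c i then β else 0) * r ^ 4 / 4
  γ := γ

/-- The periodic cell indicator of period `ℓ`: `cellPeriodic ℓ i = true ↔ ℓ ∣ i + 1`, i.e. cells at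
the sites `i ≡ ℓ - 1 (mod ℓ)` — every `ℓ`-th site, the first cell at `i = ℓ - 1` (so the cells of the
chain of length `N = M ℓ` are `ℓ - 1, 2ℓ - 1, …, N - 1`); `cellPeriodic 1`: all sites are cells (the
dense chain); `cellPeriodic 0`: no cell. [folklore] -/
def cellPeriodic (ℓ : ℕ) : ℕ → Bool := fun i => decide (ℓ ∣ i + 1)

section CellChain

variable (ω₂ lam β γ : ℝ)

/-- The bath coupling of a cell chain. [folklore] -/
@[simp] theorem cellChain_γ (c : ℕ → Bool) : (cellChain ω₂ lam β γ c).γ = γ := rfl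

/-- Cellwise, the cell chain is the pinned quartic chain with the quartic amplitudes switched by the
indicator (pinning). [folklore] -/
theorem cellChain_U (c : ℕ → Bool) (i : ℕ) :
    (cellChain ω₂ lam β γ c).U i =
      (pinnedChain ω₂ (if c i then lam else 0) (if c i then β else 0) γ).U :=
  rfl

/-- Cellwise, the cell chain is the pinned quartic chain with the quartic amplitudes switched by the
indicator (coupling). [folklore] -/
theorem cellChain_V (c : ℕ → Bool) (i : ℕ) :
    (cellChain ω₂ lam β γ c).V i =
      (pinnedChain ω₂ (if c i then lam else 0) (if c i then β else 0) γ).V :=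
  rfl

/-- All cells switched on IS the conjunct's pinned anharmonic chain (literal equality of site chains,
by `rfl`): statements about `cellChain ω₂ lam β γ (fun _ => true)` rewrite to statements about
`pinnedChain ω₂ lam β γ` through the `toSiteChain_*` agreement lemmas. [folklore] -/
theorem cellChain_const_true :
    cellChain ω₂ lam β γ (fun _ => true) = (pinnedChain ω₂ lam β γ).toSiteChain :=
  rfl

/-- No cell at all IS the pinned harmonic host `pinnedChain ω₂ 0 0 γ` (by `rfl`). [folklore] -/
theorem cellChain_const_false :
    cellChain ω₂ lam β γ (fun _ => false) = (pinnedChain ω₂ 0 0 γ).toSiteChain :=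
  rfl

/-- Locality for cell chains (steady states): at length `N` only the cells below `N` matter.
[folklore] -/
theorem cellChain_isSteadyState_congr {c c' : ℕ → Bool} {N : ℕ} (h : ∀ i, i < N → c i = c' i) :
    (cellChain ω₂ lam β γ c).IsSteadyState N = (cellChain ω₂ lam β γ c').IsSteadyState N :=
  SiteChain.isSteadyState_congr (fun i hi => by rw [cellChain_U, cellChain_U, h i hi])
    (fun i hi => by rw [cellChain_V, cellChain_V, h i hi]) rfl

/-- Locality for cell chains (currents). [folklore] -/
theorem cellChain_totalCurrent_congr {c c' : ℕ → Bool} {N : ℕ} (h : ∀ i, i < N → c i = c' i)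
    (μ : Measure (PhaseSpace N)) :
    (cellChain ω₂ lam β γ c).totalCurrent μ = (cellChain ω₂ lam β γ c').totalCurrent μ :=
  SiteChain.totalCurrent_congr (fun i hi => by rw [cellChain_V, cellChain_V, h i hi]) μ

/-- Locality for cell chains (response coefficients). [folklore] -/
theorem cellChain_isResponseCoeff_congr {c c' : ℕ → Bool} {N : ℕ} (h : ∀ i, i < N → c i = c' i) :
    (cellChain ω₂ lam β γ c).IsResponseCoeff N = (cellChain ω₂ lam β γ c').IsResponseCoeff N :=
  SiteChain.isResponseCoeff_congr (fun i hi => by rw [cellChain_U, cellChain_U, h i hi])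
    (fun i hi => by rw [cellChain_V, cellChain_V, h i hi]) rfl

end CellChain

/-- `i` is a cell of period `ℓ` iff `ℓ ∣ i + 1`. [folklore] -/
@[simp] theorem cellPeriodic_eq_true_iff (ℓ i : ℕ) : cellPeriodic ℓ i = true ↔ ℓ ∣ i + 1 := by
  simp [cellPeriodic]

/-- Period `1`: every site is a cell (the dense chain). [folklore] -/
@[simp] theorem cellPeriodic_one : cellPeriodic 1 = fun _ => true := by
  funext i; simp [cellPeriodic]

/-- Period `0`: no cell (the harmonic host). [folklore] -/
@[simp] theorem cellPeriodic_zero : cellPeriodic 0 = fun _ => false := by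
  funext i; simp [cellPeriodic]

/-- The first cell sits at `i = ℓ - 1` (`ℓ ≥ 1`). [folklore] -/
theorem cellPeriodic_sub_one {ℓ : ℕ} (hℓ : 0 < ℓ) : cellPeriodic ℓ (ℓ - 1) = true := by
  simp [cellPeriodic, Nat.sub_add_cancel hℓ]

/-- Periodicity: `cellPeriodic ℓ (i + ℓ) = cellPeriodic ℓ i`. [folklore] -/
@[simp] theorem cellPeriodic_add_self (ℓ i : ℕ) : cellPeriodic ℓ (i + ℓ) = cellPeriodic ℓ i := by
  simp only [cellPeriodic, Nat.add_right_comm i ℓ 1, Nat.dvd_add_self_right]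

/-- The dense periodic cell chain IS the conjunct's chain. [folklore] -/
theorem cellChain_cellPeriodic_one (ω₂ lam β γ : ℝ) :
    cellChain ω₂ lam β γ (cellPeriodic 1) = (pinnedChain ω₂ lam β γ).toSiteChain := by
  rw [cellPeriodic_one]; rfl

/-- The period-`0` cell chain IS the pinned harmonic host. [folklore] -/
theorem cellChain_cellPeriodic_zero (ω₂ lam β γ : ℝ) :
    cellChain ω₂ lam β γ (cellPeriodic 0) = (pinnedChain ω₂ 0 0 γ).toSiteChain := by
  rw [cellPeriodic_zero]; rfl

end Literature.MathematicalPhysics.KineticTheory.HeatConduction
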